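import Summits.FinalStateConjecture.FinalStateConjecture.Theses.PhotonSphereChannels
import Summits.FinalStateConjecture.FinalStateConjecture.Theorems.PhotonSphereChannelsExteriorEnergy
import Summits.FinalStateConjecture.FinalStateConjecture.Theorems.PhotonSphereChannelsRWPotential
import Literature.Geometry.Lorentzian.ReggeWheelerChannels
import Literature.Geometry.Lorentzian.ReggeWheelerTortoise

/-!
# Line `apoapsis-beams` for crux `PhotonSphereChannels.UniformPhotonSphereChannels` (stmt-FinalStateConjecture-10045)

Skeleton (crux-plan, planner-cruxplan-stmt-FinalStateConjecture-10045-apoapsis-beams-0, 2026-08-15).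

**This is a NEGATIVE line.** Idea card `apoapsis-beams` (ideator 2, round 1; passed triage 3/3) decides the
crux `K1 := UniformPhotonSphereChannels` NEGATIVELY: the composition below is
`UniformPhotonSphereChannels_false : ¬ UniformPhotonSphereChannels` (modulo the four stubs), in agreement
with the standing disprover's verdict (`Cruxes/UniformPhotonSphereChannels/Disproof.lean`, cycle 1:
"K1 is false as typed — refuted-substantive", sorried near-miss `not_uniformPhotonSphereChannels`) and
with the route-review refuter, prover seat 1 and the three ideators.  The skeleton audit of the harness
looks for a theorem concluding the crux decl by name; for a negative line the concluded statement is the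
named negation `NotUniformPhotonSphereChannels := ¬ UniformPhotonSphereChannels` of this file
(`ledger skeleton check … --crux-decl …ApoapsisBeams.NotUniformPhotonSphereChannels`), while
`UniformPhotonSphereChannels_false : ¬ UniformPhotonSphereChannels` is the tree-audit `refutes` edge on
the crux itself (it becomes a closed refutation once the stubs land).

Vocabulary.  The crux inlines, as `let`s, exactly the objects of
`Literature/Geometry/Lorentzian/ReggeWheelerChannels.lean` (`linePotential`, `energyDensity`,
`IsSolutionAt`/`IsSolution`, `exteriorCone`, `exteriorEnergy`, `channelEnergy`, `rwKernel`,
`kernelDeficit`, `ChannelInequality`) over a tortoise radius function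
(`ReggeWheelerTortoise.lean`: `IsTortoiseRadius M r xc` = the crux's three inline hypotheses on `r`);
`channelInequality_of_uniform` below is the definitional bridge (checked: `exact` by `rfl`-unfolding).
All stubs are stated over that vocabulary, so stub workers import only `Literature` + the route file.

THE LINE (M, a tortoise `r` centred at `xc`, the near edge `x_e = xc − ρ`, the apoapsis `x⋆ = x_e − M`,
`F(x) = (1 − 2M/r(x))/r(x)²` so that the spin-1 potential is `V_{1,ℓ} = ℓ(ℓ+1)·F` EXACTLY — the
semiclassical scaling is exact for `s = 1`, which is why the witness family uses Maxwell modes):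

* `stub_oddSolution_exists` — 1+1 well-posedness: for `V ∈ C¹` bounded and `g ∈ C²` bounded the
  Cauchy problem `ψ_tt − ψ_xx + Vψ = 0`, `ψ(0,·) = 0`, `ψ_t(0,·) = g` has a global `C²` solution, odd
  in `t` (the velocity-data twin of the LANDED `Theorems.Blindness.exists_even_solution`: Picard in null
  coordinates `Theorems.Blindness.exists_picard_fixedPoint` with diagonal data `(0, −g/2)`, the `C²`
  bootstrap of `…BlindnessWaveRegularity`, anti-symmetrisation or uniqueness
  `Theorems.WaveEnergy…eq_zero_of_data_eq_zero` for oddness).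
* (no stub) cone-energy monotonicity in `|t|` and `liminf ≤ E(±T)` are LANDED:
  `Theorems.WaveEnergy.exteriorEnergy_mono_abs_curried`, `Theorems.WaveEnergy.channel_liminf_atTop_le/atBot_le`
  (`PhotonSphereChannelsExteriorEnergy.lean`, 2026-08-15) — imported and used by the composition.
* `stub_kernelDeficit_ge_nearVelocity` — the NEAR-SIDE KERNEL CENSUS in its coercive form
  (`NearKernelIsStatic`, triage-2/3 sharpening "use odd data"): for data `(0, ψ_t(0))` with finite
  near velocity mass `D = ∫_{x<x_e} ψ_t(0)²`, the kernel deficit `inf_{p∈P(ρ)} E_ext[ψ − p](0)` is `≥ D`,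
  because a `t`-polynomial solution `p = Σ aᵢ(x)tⁱ` on the near cone has `(∂ₓ² − V)^k a₁ = 0` on
  `(−∞, x_e)` with `V = O(e^{(x−xc)/2M})`, whence `a₁ ∼` polynomial (Levinson) and `a₁ ∈ L² ⇒ a₁ = 0`.
* `stub_apoapsisRay` — THE LAG LAW (the name of the line; Chandrasekhar's null geodesics of the second
  kind): the rest-released ray `Ẍ = −F′(X)/(2F(x⋆))`, `X(0) = x⋆`, `Ẋ(0) = 0` (the `ℓ`-free spatial
  projection of the bicharacteristics of `∂_t² − ∂_x² + ℓ(ℓ+1)F` through `(x⋆, ξ = 0)`) exists globally,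
  falls monotonically into the horizon and LAGS its ingoing null companion by more than `M` at some
  finite time `T`: `X(T) + T − x⋆ > M` (proof on paper: `Ẋ² = 1 − F(X)/F(x⋆)`, total lag
  `Λ = ∫(1/√(1−F/F⋆) − 1) dX ≥ (1/2F⋆)∫_{2M}^{r⋆} dr/r² = r⋆²/4M > M`; numerically `Λ ≥ 4M ln 2`).
* `stub_beamLocalisation` — THE APOAPSIS BEAM (hardest, load-bearing): for `ℓ ≥ ℓ₀(M,r,ρ,X,T,δ,ε)` every
  `C²` solution of the spin-1 equation with the coherent-state data `(0, exp(−ℓ(x−x⋆)²/2M²))` has, at the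
  fixed time `T`, energy `≤ ε·D` outside the `δ`-tube around the classical position `X(T)` (first-order
  Gaussian beam along the ray + energy estimate for the residual: relative energy error `O(1/ℓ)`; finite
  `T`, so no Ehrenfest-time issue; the turning point at `t = 0` is harmless for complex-phase beams).
* `UniformPhotonSphereChannels_false_of` — the kernel-checked, sorry-free composition of the four
  statements (+ the landed monotonicity) into `¬ K1`: K1 at `M = 1`, `s = 1`, `xc = 0`, `r = tortoiseRadius`, `ρ = ρ₀`, `ℓ` large, the
  odd solution `ψ` with the coherent data: `c·D ≤ c·deficit ≤ E_ch⁺ + E_ch⁻ ≤ E(T) + E(−T) = 2E(T) ≤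
  2·(c/8)·D` (cone at time `T` ⊆ complement of the `δ`-tube since `X(T) = x_e − T + 2δ`), and
  `0 < D < ∞` (Gaussian) gives `c ≤ c/4`, contradiction.

Disproof.lean (cdisprove cycle 1) honoured: no `_false_without_` theorem exists yet; the line IS the
file's near-miss `not_uniformPhotonSphereChannels` made into a skeleton — it attacks exactly the
horizon-side consequence `LeftExteriorChannels` (`leftExteriorChannels_of_uniform`: the coercive side is
used only on `{x < xc − ρ}`, cf. `stub_kernelDeficit_ge_nearVelocity`), uses odd data (kernel-free
sector, Disproof item 3), a FIXED ball `ρ = ρ₀` (Disproof item 4: no `ρ₀(M)` exists; the family is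
`ℓ → ∞` at fixed `ρ`, so it does NOT touch `FixedModeChannels`, cf. `fixedModeChannels_of_uniform`), and
the non-vacuity of the tortoise hypotheses (`tortoise_hypotheses_satisfiable` there;
`ReggeWheeler.isTortoiseRadius_tortoiseRadius` here).  The one landed
`Theorems/UniformPhotonSphereChannels/Negative/EnergyDefectIdentity.lean` (weighted energy identity with
defect source, for the disprover's Rindler-frame line) refutes no stub of this file (it is an identity;
the beam stub's prover may USE it for the residual→energy step).  The file's own list "what a Lean proof
needs (i)–(iv)" is, in order, `stub_oddSolution_exists`, the landed monotonicity,
`stub_beamLocalisation`, `stub_kernelDeficit_ge_nearVelocity`, plus the lag law `stub_apoapsisRay` made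
explicit.  Negatives index: empty for the summit (2026-08-15).
-/

set_option linter.dupNamespace false
set_option linter.unusedVariables false

namespace Summit.FinalStateConjecture.FinalStateConjecture.Cruxes.UniformPhotonSphereChannels.ApoapsisBeams

open Summit.FinalStateConjecture.FinalStateConjecture.Theses.PhotonSphereChannels
open Literature.Geometry.Lorentzian Literature.Geometry.Lorentzian.ReggeWheeler
open MeasureTheory Filter Set
open scoped ENNReal Topology

/-! ## The crux in the vocabulary of `ReggeWheelerChannels` (definitional bridge, no content) -/

/-- `UniformPhotonSphereChannels` unfolds, `let` by `let`, to the uniform two-ended channel inequality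
`ChannelInequality (linePotential M s ℓ r) xc ρ c` over tortoise radius functions: the bridge is `rfl`
on every inlined object (`V ↦ linePotential`, `e ↦ energyDensity`, `IsSol ↦ IsSolutionAt`,
`Ω ↦ exteriorCone`, `P ↦ rwKernel`, `Eext ↦ exteriorEnergy`). [folklore] -/
theorem channelInequality_of_uniform (h : UniformPhotonSphereChannels) {M : ℝ} (hM : 0 < M) :
    ∃ ρ₀ : ℝ, 0 ≤ ρ₀ ∧ ∃ c : ℝ, 0 < c ∧ ∀ (r : ℝ → ℝ) (xc : ℝ), IsTortoiseRadius M r xc →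
      ∀ s ℓ : ℕ, s ≤ 2 → s ≤ ℓ → ∀ ρ : ℝ, ρ₀ ≤ ρ →
        ChannelInequality (linePotential M s ℓ r) xc ρ c := by
  obtain ⟨ρ₀, hρ₀, c, hc, H⟩ := h M hM
  refine ⟨ρ₀, hρ₀, c, hc, fun r xc hr s ℓ hs hsℓ ρ hρ φ hφ => ?_⟩
  exact H r xc hr.two_mul_lt hr.hasDerivAt hr.center s ℓ hs hsℓ ρ hρ φ hφ.1 hφ.2

/-! ## The four registered stubs -/

/-- **S1 · 1+1 well-posedness with odd data** (`stub_oddSolution_exists`).  For every BOUNDED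
potential `V ∈ C¹(ℝ)` and every BOUNDED `g ∈ C²(ℝ)` the Cauchy problem `ψ_tt − ψ_xx + V(x)ψ = 0`,
`ψ(0,·) = 0`, `ψ_t(0,·) = g` has a GLOBAL classical solution (`IsSolution`: `ψ ∈ C²(ℝ²)` and the
equation holds everywhere, second derivatives as `iteratedDeriv 2` of the slices) which is odd in time,
`ψ(−t,x) = −ψ(t,x)`.  (True without the boundedness hypotheses — unit propagation speed — but they are
exactly what the landed global Picard argument uses, and the composition only needs the bounded case:
`0 ≤ V_{1,ℓ} ≤ (ℓ(ℓ+1)+1)/4M²`, `0 < g ≤ 1`.)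
Why true / how: the velocity-data twin of the LANDED `Theorems.Blindness.exists_even_solution`
(`PhotonSphereChannelsBlindnessWaveSolution.lean`: data `(A, 0)`, `A ∈ C²` compactly supported,
`V ∈ C¹` bounded ⇒ even global `C²` solution).  In null coordinates `a = x + t`, `b = x − t`,
`c = V((a+b)/2)/4`, the data `(0, g)` read `Ψ(a,a) = 0`, `Ψ_a = g/2`, `Ψ_b = −g/2` on the diagonal, i.e.
`Theorems.Blindness.exists_picard_fixedPoint` with `A := 0`, `A' := −g` (both bounded continuous, `c`
bounded `C¹`, `Z := ∅`); the `C²` bootstrap `…BlindnessWaveRegularity.contDiff_two_psi` /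
`hasFDerivAt_psi` must be re-run with an independent `C¹` diagonal datum in place of `deriv A` (here it
is even `C²`); back to `(t,x)` by `…BlindnessWaveTransfer.iteratedDeriv_two_time_sub_space`; oddness
by the anti-symmetrisation twin of `symmetrise`, or by uniqueness
(`…FiniteSpeed.eq_zero_of_data_eq_zero` applied to `ψ(t,x) + ψ(−t,x)`).  Size M–L (templates landed). -/
theorem stub_oddSolution_exists :
    ∀ V : ℝ → ℝ, ContDiff ℝ 1 V → (∃ CV : ℝ, ∀ x, |V x| ≤ CV) →
      ∀ g : ℝ → ℝ, ContDiff ℝ 2 g → (∃ Cg : ℝ, ∀ x, |g x| ≤ Cg) →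
        ∃ ψ : ℝ → ℝ → ℝ, IsSolution V ψ ∧ (∀ x, ψ 0 x = 0) ∧
          (∀ x, deriv (fun τ ↦ ψ τ x) 0 = g x) ∧ (∀ t x, ψ (-t) x = -ψ t x) := by
  sorry

/-- **S2 · near-side kernel census, coercive form** (`stub_kernelDeficit_ge_nearVelocity`;
`NearKernelIsStatic` of the sibling cards, Disproof.lean item 3, triage-2/3 "odd data ⇒ the census is an
`L²`-Liouville statement").  For a tortoise radius function `r` (`IsTortoiseRadius M r xc`), any
`s ≤ 2 ≤ …`, `s ≤ ℓ`, an aperture `ρ ≥ 0` and ANY `ψ ∈ C²(ℝ²)` with `ψ(0,·) = 0` whose near velocity mass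
`D = ∫⁻_{x < xc−ρ} ψ_t(0,x)²` is finite:  `D ≤ kernelDeficit (linePotential M s ℓ r) xc ρ ψ`
`= inf_{p ∈ P(ρ)} ∫⁻_{ρ<|x−xc|} e[ψ − p](0,x)`.
Why true: fix `p ∈ P(ρ) = rwKernel`: `C²` on the open exterior cone and `p = Σ_{i<N} aᵢ(x)tⁱ` there.  On
the near half-line `x < x_e := xc − ρ` (so `(0,x) ∈` cone): `∂_t(ψ−p)(0,x) = ψ_t(0,x) − a₁(x)` and
`e[ψ−p](0,x) ≥ (ψ_t(0,x) − a₁(x))²`, while the far half-line contributes `≥ 0`.  The `aᵢ` are `C²` on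
`(−∞, x_e)` (Vandermonde in `t` at fixed nodes) and the equation gives `aᵢ″ − V aᵢ = (i+1)(i+2)aᵢ₊₂`, so
`(∂ₓ² − V)^k a₁ = 0` on `(−∞,x_e)` for some `k ≤ N`.  Near the horizon `V(x) = O(e^{(x−xc)/2M})`
(`IsTortoiseRadius.tortoiseCoord_eq`: `r − 2M ≍ e^{(x−xc)/2M}`), hence (Levinson / Volterra iteration
for the `2k`-system with exponentially integrable perturbation) every solution is `P(x) + o(1)` as
`x → −∞` with `P` a polynomial of degree `< 2k`, and `P = 0` forces the solution to vanish.  So either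
`a₁ ∉ L²(−∞,x_e)`, and then `∫(ψ_t(0) − a₁)² = ∞ ≥ D` (as `D < ∞`), or `a₁ ∈ L²`, `P = 0`, `a₁ ≡ 0`
and `∫_{x<x_e}(ψ_t(0) − a₁)² = D`.  (On the FAR side the analogous statement is false — `x^{−ℓ}` modes —
which is why only the near mass is claimed: the horizon side is the load-bearing side,
`Disproof.leftExteriorChannels_of_uniform`.)  Leans on: `rwKernel`, `kernelDeficit`, `exteriorCone`,
`IsTortoiseRadius.{tortoiseCoord_eq, tendsto_atBot}`, the LANDED horizon-tail bound `Theorems.rwPotential_tortoise_le_exp` (`V_{s,ℓ}(r x) ≤ C_ℓ e^{(x−xc+…)/2M}`, `PhotonSphereChannelsRWPotential.lean`) and `Theorems.tortoise_contDiff` (`r ∈ C^∞`); tree ODE library `Literature/Analysis/ODE/`: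
`LinearTransport` (`exists_transport_joint`: global transport of linear systems), `LinearSecondOrder`,
`FlowWithin.exists_solution_linear`, `JostDecay`/`JostGreen` (Volterra iteration against an integrable
tail — the `γ = 0`, polynomial-weight variant is what is needed here), `LinearVolterraDuality`;
Mathlib `gronwallBound`.  Levinson's theorem itself is not in tree.  Size L. -/
theorem stub_kernelDeficit_ge_nearVelocity :
    ∀ (M : ℝ) (r : ℝ → ℝ) (xc : ℝ), IsTortoiseRadius M r xc → ∀ s ℓ : ℕ, s ≤ 2 → s ≤ ℓ →
      ∀ ρ : ℝ, 0 ≤ ρ → ∀ ψ : ℝ → ℝ → ℝ, ContDiff ℝ 2 (Function.uncurry ψ) → (∀ x, ψ 0 x = 0) →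
        (∫⁻ x in Set.Iio (xc - ρ), ENNReal.ofReal (deriv (fun τ ↦ ψ τ x) 0 ^ 2)) < ∞ →
        (∫⁻ x in Set.Iio (xc - ρ), ENNReal.ofReal (deriv (fun τ ↦ ψ τ x) 0 ^ 2)) ≤
          kernelDeficit (linePotential M s ℓ r) xc ρ ψ := by
  sorry

/-- **S3 · the apoapsis ray and its lag** (`stub_apoapsisRay`; the LAG LAW of the idea card — rays
released at rest on the horizon side are the null geodesics of the second kind, apoapsis inside `3M`,
both ends on the horizons: Chandrasekhar 1998, Ch. 3 §20).  With `F(x) = (1 − 2M/r(x))/r(x)²`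
(so `V_{1,ℓ} = ℓ(ℓ+1)F`) and the apoapsis `x⋆ = xc − ρ − M` (one mass unit inside the near edge
`x_e = xc − ρ`), the Newton trajectory `Ẍ = −F′(X)/(2F(x⋆))`, `X(0) = x⋆`, `Ẋ(0) = 0` — the `ℓ`-free
spatial projection of the bicharacteristics of `τ² = ξ² + ℓ(ℓ+1)F(x)` through `(x⋆, ξ = 0)` — exists as
a global `C²` function, and at some time `T ≥ 0` it is still left of `x⋆` and LAGS the ingoing null ray
from `x⋆` by more than `M`: `X(T) + T − x⋆ > M`, i.e. `X(T) > x_e − T` with room.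
Why true: `F′ = f′(r)r′` is bounded and Lipschitz (`f(r) = (r−2M)/r³`, `0 < r′ < 1`), so the ODE has a
unique global solution; `Ẋ² + F(X)/F(x⋆) = 1` (multiply by `Ẋ`), `F` is strictly increasing on
`(−∞, xc]` (photon sphere at `xc`: `f′ > 0` on `(2M,3M)`), so `X` decreases for `t > 0`, never returns,
and `X → −∞`; the lag `∫₀ᵀ(1 − |Ẋ|)dt` increases to `Λ = ∫_{−∞}^{x⋆}((1 − F/F⋆)^{−1/2} − 1)dX ≥
(2F⋆)⁻¹∫_{−∞}^{x⋆}F dX = (2F⋆)⁻¹∫_{2M}^{r⋆}dr/r² = r⋆²/(4M) > M` (`r⋆ = r(x⋆) > 2M`; `dX = dr/(1−2M/r)`).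
Numerically `Λ(x_e)/M = 11.5 … 2.77 ↓ 4 ln 2` (Disproof census; triage-2 `lag.py`), always `> 1`.
Leans on: `IsTortoiseRadius.{hasDerivAt, deriv_pos, strictMono, tendsto_atBot, tortoiseCoord_eq}`;
tree ODE library: `Literature.Analysis.ODE.exists_solution_of_linearGrowth` (`LinearGrowth.lean`; the
field `(X, P) ↦ (P, −F′(X)/(2F⋆))` has bounded `F′`), `ODE.exists_solution_of_apriori_bound`
(`GlobalExistence.lean`), `eq_reflection_of_odd…` (`ReflectionSymmetry.lean`, `X` even); Mathlib
`ODE_solution_unique`, interval integrals / change of variables `t ↦ X`.  Size M–L. -/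
theorem stub_apoapsisRay :
    ∀ (M : ℝ) (r : ℝ → ℝ) (xc : ℝ), IsTortoiseRadius M r xc → ∀ ρ : ℝ, 0 ≤ ρ →
      ∃ X : ℝ → ℝ, ContDiff ℝ 2 X ∧ X 0 = xc - ρ - M ∧ deriv X 0 = 0 ∧
        (∀ t, iteratedDeriv 2 X t =
          -(deriv (fun x ↦ (1 - 2 * M / r x) / r x ^ 2) (X t)) /
            (2 * ((1 - 2 * M / r (xc - ρ - M)) / r (xc - ρ - M) ^ 2))) ∧
        ∃ T : ℝ, 0 ≤ T ∧ X T ≤ xc - ρ - M ∧ M < X T + T - (xc - ρ - M) := by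
  sorry

/-- **S4 · the apoapsis beam follows the ray** (`stub_beamLocalisation`; HARDEST, load-bearing — the
idea card's lever "Gaussian beam / coherent state released at apoapsis", in the 1+1 per-mode form the
triage asked for).  Data: tortoise `r` centred at `xc`, `ρ ≥ 0`, the apoapsis `x⋆ = xc − ρ − M`, the ray
`X` of `stub_apoapsisRay` (ANY `C²` function with `X(0) = x⋆`, `Ẋ(0) = 0`, `Ẍ = −F′(X)/(2F(x⋆))`), a
time `T ≥ 0`, a tube radius `δ > 0` and `ε > 0`.  Then there is `ℓ₀` such that for every `ℓ ≥ ℓ₀` and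
every global `C²` solution `ψ` of the SPIN-1 (Maxwell) Regge–Wheeler equation
`ψ_tt − ψ_xx + ℓ(ℓ+1)F(x)ψ = 0` (`V_{1,ℓ} = linePotential M 1 ℓ r = ℓ(ℓ+1)F` exactly, `rwPotential_one`)
with the coherent-state data `ψ(0,·) = 0`, `ψ_t(0,x) = exp(−ℓ(x − x⋆)²/2M²)` (a Gaussian of width
`M/√ℓ ≍ h^{1/2}` at rest at `x⋆`), the energy at time `T` OUTSIDE the `δ`-tube about the classical
position, `∫⁻_{δ<|x−X(T)|} e[ψ](T,x)`, is at most `ε·D`, `D = ∫⁻_{x<xc−ρ} ψ_t(0,x)²` (the near velocity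
mass, `≥` half the total energy `∫ψ_t(0)²` since the Gaussian is centred at `x⋆ < xc − ρ`).
Why plausibly true (standard first-order Gaussian beam, Ralston 1982; error bounds Liu–Runborg–Tanushev
2013): with `λ² = ℓ(ℓ+1)` build `u = a(t)e^{iλΦ}`, `Φ = S + ξ(x−X) + ½B(x−X)²`, `Im B > 0` (Riccati
along `X`, globally solvable), transport for `a`, `a(0) = −1/(λ√F(x⋆))`, `B(0) = iℓ/(λM²)`; then
`Im u` has data `(0, g(1 + O(|x−x⋆| + (x−x⋆)² + λ⁻¹)))`, the residual `□u + λ²Fu` has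
`‖·‖_{L²} = O(λ^{1/4}·λ⁻¹)` uniformly on `[0,T]`, and the energy estimate for `ψ − Im u` (the same
identity that gives uniqueness of `C²` solutions, so "every solution with these data" is harmless) gives
`E[ψ − Im u](T) ≤ C(M,r,ρ,T)·λ⁻¹·D`, while `Im u(T)` carries energy `O(e^{−cλδ²})·D` outside the tube.
So the bound holds with `ε ≍ 1/ℓ`.  Finite `T` fixed BEFORE `ℓ → ∞`: no Ehrenfest-time or caustic
issue (complex phase), and `F = f∘r` is smooth with bounded derivatives.  What would kill it: a
systematic drift of the true packet from `X(T)` by a fixed amount (excluded by the toy FD runs of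
cdisprove / seat 1 / triage 1–3: packet offsets match `Λ(x₁) − d` to 1–5 %, `q ↓ 0` like the predicted
rate).  Leans on: `IsRWSolution`/`IsSolution`, `energyDensity`, `rwPotential_one`,
`IsTortoiseRadius.contDiff_one` (bootstrap to `C^∞`); THE TREE'S GAUSSIAN-BEAM LIBRARY (Sbierski 2015
§3–4 formalised): `Literature.Analysis.ODE.GaussianBeamRiccati` (`riccati_of_jacobi`,
`exists_riccati`, `exists_riccati_on` — Riccati for the phase Hessian through the Jacobi system, for
ARBITRARY continuous coefficient paths `A, B, C`, so it applies verbatim to `H = ½(−τ² + ξ² + F(x))`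
along the apoapsis ray: `A = ½F″(X)e_x⊗e_x`, `B = 0`, `C = diag(−1,1)`, `n = Fin 2`),
`GaussianBeamRiccatiInitial` (an admissible `M(0)`), and the chart-level beam files
`Literature.Geometry.Lorentzian.GaussianBeam{Data,Phase,Amplitude,Function,Errors,Defect,Tube,
EnergyDensity,Energy,Cross}` (`BeamAmp.beam = Re(a e^{iλφ})`, `fderiv_beam_apply`,
`energy_characterisation`, leaf Gaussian integrals) — written for `□_g` in a time-foliated chart; the
1+1 operator `∂_t² − ∂_x² + λ²F` is the `y`-mode `u = ψ(t,x)e^{iλy}` of `□_G` for the static 2+1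
optical metric `G = diag(1, −1, −F(x))` (contravariant), so the bookkeeping transfers with the phase
`φ = y + Φ(t,x)`; energy method / uniqueness: `Literature.Analysis.FluidPDE.coneEnergy_eq_zero`,
`WaveCone.eq_zero_of_dalembert_eq_zero`; Mathlib `integral_gaussian` and moments.  Size XL (the beam
exists in tree only as a pattern in 3+1 chart form; the residual→energy step and the
`y`-mode reduction are new); natural internal cut for the lead: (a) inhomogeneous energy inequality for
`C²` solutions, (b) beam construction + residual bounds along `X`, (c) Gaussian tail/moment bookkeeping. -/
theorem stub_beamLocalisation :
    ∀ (M : ℝ) (r : ℝ → ℝ) (xc : ℝ), IsTortoiseRadius M r xc → ∀ ρ : ℝ, 0 ≤ ρ →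
      ∀ X : ℝ → ℝ, ContDiff ℝ 2 X → X 0 = xc - ρ - M → deriv X 0 = 0 →
        (∀ t, iteratedDeriv 2 X t =
          -(deriv (fun x ↦ (1 - 2 * M / r x) / r x ^ 2) (X t)) /
            (2 * ((1 - 2 * M / r (xc - ρ - M)) / r (xc - ρ - M) ^ 2))) →
        ∀ T : ℝ, 0 ≤ T → ∀ δ : ℝ, 0 < δ → ∀ ε : ℝ, 0 < ε → ∃ ℓ₀ : ℕ, ∀ ℓ : ℕ, ℓ₀ ≤ ℓ →
          ∀ ψ : ℝ → ℝ → ℝ, IsSolution (linePotential M 1 ℓ r) ψ → (∀ x, ψ 0 x = 0) →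
            (∀ x, deriv (fun τ ↦ ψ τ x) 0 =
              Real.exp (-(ℓ : ℝ) * (x - (xc - ρ - M)) ^ 2 / (2 * M ^ 2))) →
            (∫⁻ x in {x : ℝ | δ < |x - X T|},
                ENNReal.ofReal (energyDensity (linePotential M 1 ℓ r) ψ T x)) ≤
              ENNReal.ofReal ε *
                ∫⁻ x in Set.Iio (xc - ρ), ENNReal.ofReal (deriv (fun τ ↦ ψ τ x) 0 ^ 2) := by
  sorry

/-! ## The composition (kernel-checked, sorry-free): the four statements refute the crux -/

/-- **Composition.**  `S1 → S2 → S3 → S4 → ¬ UniformPhotonSphereChannels` — a real proof over the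
statements of the four stubs (taken as hypotheses via `type_of%`, so this theorem is closed: its only
axioms are `propext`, `Classical.choice`, `Quot.sound`) and the LANDED cone-energy monotonicity
`Theorems.WaveEnergy.exteriorEnergy_mono_abs_curried` / `Theorems.WaveEnergy.channel_liminf_atTop_le` / `…atBot_le`.
Witness: `M = 1`, `s = 1`, `xc = 0`, `r = tortoiseRadius`, `ρ = ρ₀`, `ℓ = max ℓ₀ 1`, the odd solution
with coherent data at `x⋆ = −ρ₀ − 1`. -/
theorem UniformPhotonSphereChannels_false_of
    (h₁ : type_of% stub_oddSolution_exists)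
    (h₃ : type_of% stub_kernelDeficit_ge_nearVelocity)
    (h₄ : type_of% stub_apoapsisRay)
    (h₅ : type_of% stub_beamLocalisation) :
    ¬ UniformPhotonSphereChannels := by
  intro hK1
  -- K1 at mass `M = 1`, in vocabulary form
  obtain ⟨ρ₀, hρ₀, c, hc, H⟩ := channelInequality_of_uniform hK1 one_pos
  -- the Schwarzschild tortoise radius function with the photon sphere at `xc = 0`
  have hr : IsTortoiseRadius 1 (tortoiseRadius one_pos 0) 0 := isTortoiseRadius_tortoiseRadius one_pos 0
  generalize hr_def : tortoiseRadius one_pos 0 = r at hr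
  have hr0 : ∀ x, r x ≠ 0 := fun x ↦ (hr.pos x).ne'
  -- S3 (ray): the apoapsis ray released at rest at `x⋆ = 0 - ρ₀ - 1` and a time `T` with lag `> 1`
  obtain ⟨X, hXC2, hX0, hX1, hXode, T, hT, hXT, hlag⟩ := h₄ 1 r 0 hr ρ₀ hρ₀
  -- tube radius and tolerance
  set δ : ℝ := (X T + T - (0 - ρ₀ - 1) - 1) / 2 with hδ_def
  have hδ : 0 < δ := by rw [hδ_def]; linarith
  have hε : 0 < c / 8 := by positivity
  -- S4 (beam): from `ℓ₀` on, the coherent state follows the ray up to time `T`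
  obtain ⟨ℓ₀, hℓ₀⟩ := h₅ 1 r 0 hr ρ₀ hρ₀ X hXC2 hX0 hX1 hXode T hT δ hδ (c / 8) hε
  set ℓ : ℕ := max ℓ₀ 1 with hℓ_def
  have hℓ₀ℓ : ℓ₀ ≤ ℓ := le_max_left _ _
  have h1ℓ : 1 ≤ ℓ := le_max_right _ _
  -- the spin-1 potential is `C¹` (tortoise `r` is `C¹`), non-negative and bounded by `(ℓ(ℓ+1)+1)/4`
  have hVC1 : ContDiff ℝ 1 (linePotential 1 1 ℓ r) := by
    unfold linePotential rwPotential
    exact (contDiff_const.sub (contDiff_const.div hr.contDiff_one hr0)).mul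
      ((contDiff_const.div (hr.contDiff_one.pow 2) fun x ↦ pow_ne_zero _ (hr0 x)).add
        (contDiff_const.div (hr.contDiff_one.pow 3) fun x ↦ pow_ne_zero _ (hr0 x)))
  have hVd : Differentiable ℝ (linePotential 1 1 ℓ r) := hVC1.differentiable one_ne_zero
  have hVnn : ∀ x, 0 ≤ linePotential 1 1 ℓ r x :=
    linePotential_nonneg zero_le_one h1ℓ hr.two_mul_lt
  have hVbd : ∃ CV : ℝ, ∀ x, |linePotential 1 1 ℓ r x| ≤ CV := by
    refine ⟨((ℓ : ℝ) * ((ℓ : ℝ) + 1) + 1) / (2 * 1) ^ 2, fun x ↦ ?_⟩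
    rw [abs_of_nonneg (hVnn x)]
    have h1 : linePotential 1 1 ℓ r x ≤ ((ℓ : ℝ) * ((ℓ : ℝ) + 1) + 1) / r x ^ 2 :=
      Theorems.rwPotential_le_div_sq one_pos (hr.two_mul_lt x)
    refine h1.trans ?_
    have h2 : (2 * 1 : ℝ) ^ 2 ≤ r x ^ 2 := by
      have := hr.two_mul_lt x
      nlinarith
    exact div_le_div_of_nonneg_left (by positivity) (by positivity) h2
  -- the coherent-state velocity profile: `C²` and bounded by `1`
  have hgC2 : ContDiff ℝ 2 (fun x : ℝ ↦
      Real.exp (-(ℓ : ℝ) * (x - (0 - ρ₀ - 1)) ^ 2 / (2 * (1 : ℝ) ^ 2))) := by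
    fun_prop
  have hg1 : ∀ x : ℝ, Real.exp (-(ℓ : ℝ) * (x - (0 - ρ₀ - 1)) ^ 2 / (2 * (1 : ℝ) ^ 2)) ≤ 1 := by
    intro x
    rw [Real.exp_le_one_iff]
    have : 0 ≤ (ℓ : ℝ) * (x - (0 - ρ₀ - 1)) ^ 2 := by positivity
    have h2 : -(ℓ : ℝ) * (x - (0 - ρ₀ - 1)) ^ 2 / (2 * (1 : ℝ) ^ 2)
        = -(((ℓ : ℝ) * (x - (0 - ρ₀ - 1)) ^ 2) / 2) := by ring
    rw [h2]
    linarith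
  have hgbd : ∃ Cg : ℝ, ∀ x : ℝ,
      |Real.exp (-(ℓ : ℝ) * (x - (0 - ρ₀ - 1)) ^ 2 / (2 * (1 : ℝ) ^ 2))| ≤ Cg :=
    ⟨1, fun x ↦ by rw [abs_of_pos (Real.exp_pos _)]; exact hg1 x⟩
  -- S1: the odd global solution with data `(0, g)`
  obtain ⟨ψ, hsol, hψ0, hψ1, hodd⟩ := h₁ (linePotential 1 1 ℓ r) hVC1 hVbd _ hgC2 hgbd
  -- K1 applied to `ψ` (s = 1 ≤ 2, 1 ≤ ℓ, ρ = ρ₀)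
  have INEQ := H r 0 hr 1 ℓ (by norm_num) h1ℓ ρ₀ le_rfl ψ hsol
  -- the near velocity mass `D` is finite and positive (Gaussian)
  have hDtop : (∫⁻ x in Set.Iio (0 - ρ₀), ENNReal.ofReal (deriv (fun τ ↦ ψ τ x) 0 ^ 2)) < ∞ := by
    have hb : (0 : ℝ) < (ℓ : ℝ) / 2 := by positivity
    have hint : Integrable (fun x : ℝ ↦ Real.exp (-((ℓ : ℝ) / 2) * (x - (0 - ρ₀ - 1)) ^ 2)) :=
      (integrable_exp_neg_mul_sq hb).comp_sub_right (0 - ρ₀ - 1)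
    refine lt_of_le_of_lt ?_ hint.lintegral_lt_top
    refine (setLIntegral_le_lintegral _ _).trans (lintegral_mono fun x ↦ ?_)
    rw [hψ1 x]
    apply ENNReal.ofReal_le_ofReal
    have hg1 := hg1 x
    have hg0 : 0 ≤ Real.exp (-(ℓ : ℝ) * (x - (0 - ρ₀ - 1)) ^ 2 / (2 * (1 : ℝ) ^ 2)) :=
      (Real.exp_pos _).le
    have heq : Real.exp (-((ℓ : ℝ) / 2) * (x - (0 - ρ₀ - 1)) ^ 2)
        = Real.exp (-(ℓ : ℝ) * (x - (0 - ρ₀ - 1)) ^ 2 / (2 * (1 : ℝ) ^ 2)) := by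
      congr 1; ring
    rw [heq]
    calc Real.exp (-(ℓ : ℝ) * (x - (0 - ρ₀ - 1)) ^ 2 / (2 * (1 : ℝ) ^ 2)) ^ 2
        = Real.exp (-(ℓ : ℝ) * (x - (0 - ρ₀ - 1)) ^ 2 / (2 * (1 : ℝ) ^ 2)) *
            Real.exp (-(ℓ : ℝ) * (x - (0 - ρ₀ - 1)) ^ 2 / (2 * (1 : ℝ) ^ 2)) := by ring
      _ ≤ 1 * Real.exp (-(ℓ : ℝ) * (x - (0 - ρ₀ - 1)) ^ 2 / (2 * (1 : ℝ) ^ 2)) :=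
            mul_le_mul_of_nonneg_right hg1 hg0
      _ = _ := one_mul _
  have hDpos : (∫⁻ x in Set.Iio (0 - ρ₀), ENNReal.ofReal (deriv (fun τ ↦ ψ τ x) 0 ^ 2)) ≠ 0 := by
    have hsub : Set.Ioo (0 - ρ₀ - 1 - 1) (0 - ρ₀ - 1) ⊆ Set.Iio (0 - ρ₀) := by
      intro x hx
      simp only [Set.mem_Ioo, Set.mem_Iio] at hx ⊢
      linarith [hx.2]
    have hlow : ∀ x ∈ Set.Ioo (0 - ρ₀ - 1 - 1) (0 - ρ₀ - 1),
        ENNReal.ofReal (Real.exp (-(ℓ : ℝ) / 2) ^ 2) ≤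
          ENNReal.ofReal (deriv (fun τ ↦ ψ τ x) 0 ^ 2) := by
      intro x hx
      rw [hψ1 x]
      apply ENNReal.ofReal_le_ofReal
      have hx1 : (x - (0 - ρ₀ - 1)) ^ 2 ≤ 1 := by
        simp only [Set.mem_Ioo] at hx
        have h1 : -1 ≤ x - (0 - ρ₀ - 1) := by linarith [hx.1]
        have h2 : x - (0 - ρ₀ - 1) ≤ 1 := by linarith [hx.2]
        nlinarith
      have hle : -(ℓ : ℝ) / 2 ≤ -(ℓ : ℝ) * (x - (0 - ρ₀ - 1)) ^ 2 / (2 * (1 : ℝ) ^ 2) := by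
        have hl : (0 : ℝ) ≤ ℓ := by positivity
        have : (ℓ : ℝ) * (x - (0 - ρ₀ - 1)) ^ 2 ≤ ℓ * 1 := mul_le_mul_of_nonneg_left hx1 hl
        have h2 : -(ℓ : ℝ) * (x - (0 - ρ₀ - 1)) ^ 2 / (2 * (1 : ℝ) ^ 2)
            = -(((ℓ : ℝ) * (x - (0 - ρ₀ - 1)) ^ 2) / 2) := by ring
        rw [h2]
        linarith
      have hmono := Real.exp_le_exp.2 hle
      have h0 : 0 ≤ Real.exp (-(ℓ : ℝ) / 2) := (Real.exp_pos _).le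
      nlinarith [hmono, h0, Real.exp_pos (-(ℓ : ℝ) * (x - (0 - ρ₀ - 1)) ^ 2 / (2 * (1 : ℝ) ^ 2))]
    have hmeas : MeasurableSet (Set.Ioo (0 - ρ₀ - 1 - 1) (0 - ρ₀ - 1)) := measurableSet_Ioo
    have hconst := setLIntegral_mono' (μ := volume) hmeas hlow
    rw [setLIntegral_const, Real.volume_Ioo] at hconst
    have hpos : 0 < ENNReal.ofReal (Real.exp (-(ℓ : ℝ) / 2) ^ 2) *
        ENNReal.ofReal (0 - ρ₀ - 1 - (0 - ρ₀ - 1 - 1)) := by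
      apply ENNReal.mul_pos
      · exact (ENNReal.ofReal_pos.2 (by positivity)).ne'
      · exact (ENNReal.ofReal_pos.2 (by norm_num)).ne'
    exact (lt_of_lt_of_le (lt_of_lt_of_le hpos hconst) (lintegral_mono_set hsub)).ne'
  -- S2 (census): the deficit dominates the near velocity mass
  have hdef := h₃ 1 r 0 hr 1 ℓ (by norm_num) h1ℓ ρ₀ hρ₀ ψ hsol.1 hψ0 hDtop
  -- LANDED (Theorems.PhotonSphereChannelsExteriorEnergy): the exterior energy is monotone in `|t|`,
  -- hence the channel energies at ±∞ are below its values at ±T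
  have hmono : ∀ ⦃t₁ t₂ : ℝ⦄, |t₁| ≤ |t₂| → 0 ≤ t₁ * t₂ →
      exteriorEnergy (linePotential 1 1 ℓ r) 0 ρ₀ ψ t₂ ≤
        exteriorEnergy (linePotential 1 1 ℓ r) 0 ρ₀ ψ t₁ :=
    fun t₁ t₂ habs hsign ↦ Theorems.WaveEnergy.exteriorEnergy_mono_abs_curried hVd hVnn hsol.1
      (fun t x ↦ hsol.2 (t, x)) 0 hρ₀ habs hsign
  have hchF : channelEnergy (linePotential 1 1 ℓ r) 0 ρ₀ ψ atTop ≤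
      exteriorEnergy (linePotential 1 1 ℓ r) 0 ρ₀ ψ T :=
    Theorems.WaveEnergy.channel_liminf_atTop_le hmono hT
  have hchB : channelEnergy (linePotential 1 1 ℓ r) 0 ρ₀ ψ atBot ≤
      exteriorEnergy (linePotential 1 1 ℓ r) 0 ρ₀ ψ (-T) :=
    Theorems.WaveEnergy.channel_liminf_atBot_le hmono (by linarith)
  -- oddness: the exterior energy at `-T` equals that at `T`
  have heven : exteriorEnergy (linePotential 1 1 ℓ r) 0 ρ₀ ψ (-T) =
      exteriorEnergy (linePotential 1 1 ℓ r) 0 ρ₀ ψ T := by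
    have hpt : ∀ x, energyDensity (linePotential 1 1 ℓ r) ψ (-T) x =
        energyDensity (linePotential 1 1 ℓ r) ψ T x := by
      intro x
      have e1 : deriv (fun τ ↦ ψ τ x) (-T) = deriv (fun τ ↦ ψ τ x) T := by
        have hfun : (fun τ ↦ ψ τ x) = -(fun τ ↦ ψ (-τ) x) := by
          funext τ
          simp only [Pi.neg_apply]
          have := hodd (-τ) x
          rw [neg_neg] at this
          linarith
        have h1 := deriv_comp_neg (fun τ ↦ ψ τ x) (-T)
        simp only [neg_neg] at h1
        conv_lhs => rw [hfun]
        rw [deriv.neg, h1, neg_neg]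
      have e2 : deriv (ψ (-T)) x = -deriv (ψ T) x := by
        have hfun : ψ (-T) = -(ψ T) := funext fun y ↦ by simpa using hodd T y
        rw [hfun, deriv.neg]
      have e3 : ψ (-T) x = -ψ T x := hodd T x
      unfold energyDensity
      rw [e1, e2, e3]
      ring
    unfold exteriorEnergy
    rw [abs_neg]
    exact lintegral_congr fun x ↦ by rw [hpt x]
  -- the exterior cone at time `T` lies outside the `δ`-tube about `X T`
  have hcone : {x : ℝ | ρ₀ + |T| < |x - 0|} ⊆ {x : ℝ | δ < |x - X T|} := by
    intro x hx
    simp only [Set.mem_setOf_eq, sub_zero] at hx ⊢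
    rw [abs_of_nonneg hT] at hx
    have hX : X T = -ρ₀ - T + 2 * δ := by rw [hδ_def]; ring
    rcases le_or_gt 0 x with hx0 | hx0
    · rw [abs_of_nonneg hx0] at hx
      rw [abs_of_pos (by linarith)]
      linarith
    · rw [abs_of_neg hx0] at hx
      rw [abs_of_neg (by linarith)]
      linarith
  -- S4 applied: energy in the cone at time `T` is at most `(c/8)·D`
  have hbeam := hℓ₀ ℓ hℓ₀ℓ ψ hsol hψ0 hψ1
  have hET : exteriorEnergy (linePotential 1 1 ℓ r) 0 ρ₀ ψ T ≤
      ENNReal.ofReal (c / 8) *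
        ∫⁻ x in Set.Iio (0 - ρ₀), ENNReal.ofReal (deriv (fun τ ↦ ψ τ x) 0 ^ 2) :=
    (lintegral_mono_set hcone).trans hbeam
  -- assemble: c·D ≤ c·deficit ≤ E_ch⁺ + E_ch⁻ ≤ 2E(T) ≤ 2(c/8)·D
  have key : ENNReal.ofReal c *
        (∫⁻ x in Set.Iio (0 - ρ₀), ENNReal.ofReal (deriv (fun τ ↦ ψ τ x) 0 ^ 2)) ≤
      (2 * ENNReal.ofReal (c / 8)) *
        (∫⁻ x in Set.Iio (0 - ρ₀), ENNReal.ofReal (deriv (fun τ ↦ ψ τ x) 0 ^ 2)) :=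
    calc ENNReal.ofReal c *
          (∫⁻ x in Set.Iio (0 - ρ₀), ENNReal.ofReal (deriv (fun τ ↦ ψ τ x) 0 ^ 2))
        ≤ ENNReal.ofReal c * kernelDeficit (linePotential 1 1 ℓ r) 0 ρ₀ ψ :=
          by gcongr
      _ ≤ channelEnergy (linePotential 1 1 ℓ r) 0 ρ₀ ψ atTop +
            channelEnergy (linePotential 1 1 ℓ r) 0 ρ₀ ψ atBot := INEQ
      _ ≤ exteriorEnergy (linePotential 1 1 ℓ r) 0 ρ₀ ψ T +
            exteriorEnergy (linePotential 1 1 ℓ r) 0 ρ₀ ψ (-T) := add_le_add hchF hchB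
      _ = 2 * exteriorEnergy (linePotential 1 1 ℓ r) 0 ρ₀ ψ T := by rw [heven, two_mul]
      _ ≤ 2 * (ENNReal.ofReal (c / 8) *
            ∫⁻ x in Set.Iio (0 - ρ₀), ENNReal.ofReal (deriv (fun τ ↦ ψ τ x) 0 ^ 2)) :=
          by gcongr
      _ = _ := by rw [mul_assoc]
  have key' : ENNReal.ofReal c ≤ 2 * ENNReal.ofReal (c / 8) :=
    (ENNReal.mul_le_mul_iff_left hDpos hDtop.ne).1 key
  rw [← ENNReal.ofReal_ofNat, ← ENNReal.ofReal_mul (by norm_num),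
    ENNReal.ofReal_le_ofReal_iff (by positivity)] at key'
  linarith

/-! ## The line's target: the crux is false -/

/-- The deciding statement of this (negative) line: **`UniformPhotonSphereChannels` is false**.  Named so
that the skeleton audit can see the composition conclude it by name
(`ledger skeleton check … --crux-decl …ApoapsisBeams.NotUniformPhotonSphereChannels`); it is literally
`¬` the route decl. -/
def NotUniformPhotonSphereChannels : Prop := ¬ UniformPhotonSphereChannels

/-- **K1 is false** (refutation edge on the crux; closed once the four stubs land — then this theorem is
proposed as `--kind refutation` for stmt-FinalStateConjecture-10045). -/
theorem UniformPhotonSphereChannels_false : ¬ UniformPhotonSphereChannels :=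
  UniformPhotonSphereChannels_false_of stub_oddSolution_exists
    stub_kernelDeficit_ge_nearVelocity stub_apoapsisRay stub_beamLocalisation

/-- The skeleton's concluding theorem BY NAME: `stubs ⊢ NotUniformPhotonSphereChannels`. -/
theorem not_uniformPhotonSphereChannels : NotUniformPhotonSphereChannels :=
  UniformPhotonSphereChannels_false

end Summit.FinalStateConjecture.FinalStateConjecture.Cruxes.UniformPhotonSphereChannels.ApoapsisBeams
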